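import Summits.ResolutionOfSingularities.ResolutionOfSingularities.Theorems.HilbertSamuelEliminationSigmaMaxModificationsCorridor3OpenContent
import Summits.ResolutionOfSingularities.ResolutionOfSingularities.Theorems.HilbertSamuelEliminationSigmaMaxModificationsCorridor3QuadricGap
import HarnessLib

/-!
# `SigmaMaxModificationsCorridor3` (stmt-19249) / `SigmaMaxModifications` (stmt-18506) — the OPEN CONTENT
# after the quadric gap (chain w42, 2026-08-26, second certificate)

[OURS · L1 W4.2] With the quadric gap landed (`quadricGap`, `tameNu3_of_prime_le_three`, p465771) the tame
regime statement is needed only for primes `p ≥ 5`. Kernel-checked, modulo the two printed theorems (CJS LNM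
2270 Thm. 6.28 in `ν`-form; CP 2019 Thm. 1.1):

* `tameNu3_of_ge5` — the all-primes tame statement from its `p ≥ 5` part (the registered `stub_tameNu3_ge5`);
* `sigmaMaxModificationsCorridor3_of_tame5_wild` — the child crux from `stub_tameNu3_ge5` and `stub_wildNu3`;
* `sigmaMaxModifications_of_tame5_wild` — the parent crux from the same two and the residual `DimGe4@base`.

NOT a statement of any manuscript. [cite: CossartJannsenSaito2020, Def. 6.14, Def. 6.15, Rem. 6.29]
[cite: CossartPiltant2019, Thm. 1.1]
-/

set_option linter.dupNamespace false -- mandated namespace of this single-conjunct summit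

noncomputable section

open CategoryTheory AlgebraicGeometry TopologicalSpace Topology
open Literature.AlgebraicGeometry.Resolution Literature.RingTheory.HilbertSamuel
open Summit.ResolutionOfSingularities.ResolutionOfSingularities.Theses.HilbertSamuelElimination

namespace Summit.ResolutionOfSingularities.ResolutionOfSingularities.Theorems.SigmaMaxModificationsCorridor3.TameWild

/-- **The tame statement for all primes from its `p ≥ 5` part** (`p ≤ 3`: quadric gap; `p = 4` is not prime).
[cite: CossartJannsenSaito2020, Rem. 6.29] -/
theorem tameNu3_of_ge5
    (hTame5 : (∀ p : ℕ, p.Prime → 5 ≤ p → ∀ (k : Type) [Field k] [CharP k p] [PerfectField k] (Y : Scheme.{0})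
      (g : Y ⟶ Spec (.of k)), IsSeparated g → LocallyOfFiniteType g → QuasiCompact g →
      IsReduced Y → ((3 : ℕ) : WithBot ℕ∞) ≤ topologicalKrullDim Y →
      topologicalKrullDim Y ≤ ((3 : ℕ) : WithBot ℕ∞) →
      ∀ ν : ℕ → ℕ, Maximal (· ∈ Scheme.hsValues Y 3) ν → ν ≠ iterPSum 3 Phi →
        IsTameValue p ν →
        ¬ Disjoint (closure ((Scheme.regularLocus Y)ᶜ \ Scheme.hsStratum Y 3 ν))
            (Scheme.hsStratum Y 3 ν) →
        NuMod Y 3 3 ν)) :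
    ∀ p : ℕ, p.Prime → ∀ (k : Type) [Field k] [CharP k p] [PerfectField k] (Y : Scheme.{0})
      (g : Y ⟶ Spec (.of k)), IsSeparated g → LocallyOfFiniteType g → QuasiCompact g →
      IsReduced Y → ((3 : ℕ) : WithBot ℕ∞) ≤ topologicalKrullDim Y →
      topologicalKrullDim Y ≤ ((3 : ℕ) : WithBot ℕ∞) →
      ∀ ν : ℕ → ℕ, Maximal (· ∈ Scheme.hsValues Y 3) ν → ν ≠ iterPSum 3 Phi →
        IsTameValue p ν →
        ¬ Disjoint (closure ((Scheme.regularLocus Y)ᶜ \ Scheme.hsStratum Y 3 ν))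
            (Scheme.hsStratum Y 3 ν) →
        NuMod Y 3 3 ν := by
  intro p hp
  by_cases h5 : 5 ≤ p
  · exact hTame5 p hp h5
  · have hp3 : p ≤ 3 := by
      have h2 := hp.two_le
      interval_cases p <;> first | omega | exact absurd hp (by decide)
    exact tameNu3_of_prime_le_three p hp hp3

/-- **`SigmaMaxModificationsCorridor3` from the `p ≥ 5` tame statement and the wild statement**, modulo the
two printed facts. [cite: CossartJannsenSaito2020, Def. 6.14, Def. 6.15] [cite: CossartPiltant2019, Thm. 1.1] -/
theorem sigmaMaxModificationsCorridor3_of_tame5_wild (hν : CossartJannsenSaito2020_nuElimination.{0})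
    (hCP : CossartPiltant2019General.{0})
    (hTame5 : (∀ p : ℕ, p.Prime → 5 ≤ p → ∀ (k : Type) [Field k] [CharP k p] [PerfectField k] (Y : Scheme.{0})
      (g : Y ⟶ Spec (.of k)), IsSeparated g → LocallyOfFiniteType g → QuasiCompact g →
      IsReduced Y → ((3 : ℕ) : WithBot ℕ∞) ≤ topologicalKrullDim Y →
      topologicalKrullDim Y ≤ ((3 : ℕ) : WithBot ℕ∞) →
      ∀ ν : ℕ → ℕ, Maximal (· ∈ Scheme.hsValues Y 3) ν → ν ≠ iterPSum 3 Phi →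
        IsTameValue p ν →
        ¬ Disjoint (closure ((Scheme.regularLocus Y)ᶜ \ Scheme.hsStratum Y 3 ν))
            (Scheme.hsStratum Y 3 ν) →
        NuMod Y 3 3 ν))
    (hWild : (∀ p : ℕ, p.Prime → ∀ (k : Type) [Field k] [CharP k p] (Y : Scheme.{0})
      (g : Y ⟶ Spec (.of k)), IsSeparated g → LocallyOfFiniteType g → QuasiCompact g →
      IsReduced Y → ((3 : ℕ) : WithBot ℕ∞) ≤ topologicalKrullDim Y →
      topologicalKrullDim Y ≤ ((3 : ℕ) : WithBot ℕ∞) →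
      ∀ ν : ℕ → ℕ, Maximal (· ∈ Scheme.hsValues Y 3) ν → ν ≠ iterPSum 3 Phi →
        ¬ (PerfectField k ∧ IsTameValue p ν) →
        ¬ Disjoint (closure ((Scheme.regularLocus Y)ᶜ \ Scheme.hsStratum Y 3 ν))
            (Scheme.hsStratum Y 3 ν) →
        NuMod Y 3 3 ν)) :
    SigmaMaxModificationsCorridor3 :=
  sigmaMaxModificationsCorridor3_of_tame_wild hν hCP (tameNu3_of_ge5 hTame5) hWild

/-- **`SigmaMaxModifications` from the `p ≥ 5` tame statement, the wild statement and `DimGe4@base`**, modulo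
the two printed facts — the honest open content of stmt-18506 after chain w42's first day.
[cite: CossartJannsenSaito2020, Def. 6.15, Cor. 6.18, Rem. 6.29] [cite: CossartPiltant2019, Thm. 1.1] -/
theorem sigmaMaxModifications_of_tame5_wild (hν : CossartJannsenSaito2020_nuElimination.{0})
    (hCP : CossartPiltant2019General.{0})
    (hTame5 : (∀ p : ℕ, p.Prime → 5 ≤ p → ∀ (k : Type) [Field k] [CharP k p] [PerfectField k] (Y : Scheme.{0})
      (g : Y ⟶ Spec (.of k)), IsSeparated g → LocallyOfFiniteType g → QuasiCompact g →
      IsReduced Y → ((3 : ℕ) : WithBot ℕ∞) ≤ topologicalKrullDim Y →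
      topologicalKrullDim Y ≤ ((3 : ℕ) : WithBot ℕ∞) →
      ∀ ν : ℕ → ℕ, Maximal (· ∈ Scheme.hsValues Y 3) ν → ν ≠ iterPSum 3 Phi →
        IsTameValue p ν →
        ¬ Disjoint (closure ((Scheme.regularLocus Y)ᶜ \ Scheme.hsStratum Y 3 ν))
            (Scheme.hsStratum Y 3 ν) →
        NuMod Y 3 3 ν))
    (hWild : (∀ p : ℕ, p.Prime → ∀ (k : Type) [Field k] [CharP k p] (Y : Scheme.{0})
      (g : Y ⟶ Spec (.of k)), IsSeparated g → LocallyOfFiniteType g → QuasiCompact g →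
      IsReduced Y → ((3 : ℕ) : WithBot ℕ∞) ≤ topologicalKrullDim Y →
      topologicalKrullDim Y ≤ ((3 : ℕ) : WithBot ℕ∞) →
      ∀ ν : ℕ → ℕ, Maximal (· ∈ Scheme.hsValues Y 3) ν → ν ≠ iterPSum 3 Phi →
        ¬ (PerfectField k ∧ IsTameValue p ν) →
        ¬ Disjoint (closure ((Scheme.regularLocus Y)ᶜ \ Scheme.hsStratum Y 3 ν))
            (Scheme.hsStratum Y 3 ν) →
        NuMod Y 3 3 ν))
    (hge4 : (∀ p : ℕ, p.Prime → ∀ (k : Type) [Field k] [CharP k p] (X : Scheme.{0})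
      (f : X ⟶ Spec (.of k)), IsSeparated f → LocallyOfFiniteType f → QuasiCompact f →
      IsReduced X → ¬ Scheme.IsRegular X → ∀ N : ℕ, 4 ≤ N →
      (N : WithBot ℕ∞) ≤ topologicalKrullDim X → topologicalKrullDim X ≤ (N : WithBot ℕ∞) →
        ∃ (X' : Scheme.{0}) (π : X' ⟶ X), IsProper π ∧ IsReduced X' ∧
          topologicalKrullDim X' ≤ ((N : ℕ) : WithBot ℕ∞) ∧
          (∀ U : X.Opens, (U : Set X) ⊆ (Scheme.hsMaxLocus X N)ᶜ → IsIso (π ∣_ U)) ∧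
          Dense ((fun x' => π.base x') ⁻¹' (Scheme.hsMaxLocus X N)ᶜ) ∧
          (∀ x' : X', Scheme.hsFun X' N x' ≤ Scheme.hsFun X N (π.base x')) ∧
          ∀ ν : ℕ → ℕ, Maximal (· ∈ Scheme.hsValues X N) ν → ν ∉ Scheme.hsValues X' N)) :
    SigmaMaxModifications :=
  sigmaMaxModifications_of_tame_wild hν hCP (tameNu3_of_ge5 hTame5) hWild hge4

end Summit.ResolutionOfSingularities.ResolutionOfSingularities.Theorems.SigmaMaxModificationsCorridor3.TameWild

end
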